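import Summits.QuantumFields.YangMills.Theorems.BalabanUVNodesN08AlphaEq324RowClassSocketEndTilted
import Literature.MathematicalPhysics.QuantumFieldTheory.Balaban1983to89.B1Eq324BenfattoClassTorusGaugeFluctuation

/-!
# Route «BalabanUVNodes», Track-A DAG node N08 = [Balaban1985UV3] Thm 1 p. 257 ∕ Thm 2 p. 272 — ONE LAW PER STEP, HISTORY-DEPENDENT REGIONS, THE PIPELINE FIRES:
# the (α)-row `h324` at EVERY history and background for the LITERAL tower datum whose step block carries the SINGLE printed zero-background gauge-field
# fluctuation Gaussian `𝒩(0,(Cᵀ·Re Δ_k·C)⁻¹)` of [Balaban1984PropagatorsII] (2.155) on ALL free bond variables of the torus, history-dependent region boxes and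
# (history, background)-dependent TILTED potentials (part 15 of the class socket; the constructive face of part 14)

Cell `pub-ymgap`, seat `pub-ymgap-dag-n08-d` gen 23 (CLAIM-81 ∕ INTENT-81; first refusal to seat n08-w4's successor given on the bus).  `bears_on: R4∕N08`;
filed `--supports stmt-QuantumFields-27364` (K1⁹, helper).  THEOREMS ONLY (def-free, sorry-free, standard axioms); seat n08-w4's parts 1–13, part 14
(`…RowClassSocketEndTilted`, p657051) and the Literature road (`…ClassMarginalTilt`, p655217 ∕ p656438; `…ClassTorusGaugeFluctuation`, p645592) are consumed
BY NAME and left untouched.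

WHY (seat n08-w4 g6's CHECK E, `N08-SOCKET-END-A6-g6.md` §9; part 14's answer).  The carrier types ONE fluctuation law `(𝔖 k).μ` and ONE variable space
`(𝔖 k).Fl` per step (ruling R-324), the history entering only through `box h` and `𝒱 h U`, while print's `dμ_{C^{(k)}}` ([Balaban1985UV3] (58) p. 270)
lives on the variables of the region `Λ_{k+1}(h)` — it depends on the history in DIMENSION and, at a general background, in COVARIANCE.  Part 10
(`…SocketEndTorusGauge`, p649137) presents the block per `(h, U)` by the sub-family Gaussian `𝒩(0,(C_Sᵀ·Re Δ_k·C_S)⁻¹)∘(Φ h U)⁻¹` — a hypothesis that ONE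
`𝔖` cannot satisfy for two histories with different sub-families `S` (this IS CHECK E), so its unconditional §2 fires for ONE history-independent
sub-family only.  Part 14 displayed the way out (marginal ∘ tilt: ONE law `𝒩(0,K)`, the `(h, U)`-dependence in the region box and in the tilted potential
`H_J + Q + log(Z_S∕Z_{A₁})`); THIS part exhibits the datum: for the printed zero-background member the hypotheses of part 14's END are JOINTLY inhabited by
ONE literal `StepSeries` block with GENUINELY history-dependent regions — the (α)-socket ∘ class-road pipeline fires END TO END under one law per step.
The member on the region `I h` is the PRINCIPAL BLOCK `A|_{I h}` of the one precision `A = Cᵀ·Re Δ_k·C` (re-indexed on its bent window) — NOT the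
marginal precision `(K_{I h,I h})⁻¹` of the one law — so the tilt `Q_h = −½⟨z,(A|_{I h} − (K_{II})⁻¹)z⟩_{I h}` is a genuine, history-dependent quadratic
form and `c_h = log(Z_{(K_{II})⁻¹}∕Z_{A|_{I h}})` a genuine constant ([Balaban1985UV3] (58): `dμ_{C^{(k)}}` on `Λ_{k+1}(h)` is the Gaussian of the
restricted quadratic form `½⟨A′, Δ^{(k)}A′⟩`, i.e. of the principal block, p. 270).
* §1 ★ `extAlong_apply_of_mem`, `measurable_extAlong`, `measurableSet_blockBox`, `preimage_blockBox_eq`, `blockBox_image_eq` — glue for the block `(B′ → ℝ)`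
  read on the bent window through `e : B′ ≃ Λ` (extension by zero off `Λ`; the block box pulls back to print's region box as a SET; for a region handed over
  as a sub-family `Bv ⊆ B′`, `I = e(Bv)`, it IS the sub-family's own box).
* §2 ★★★★★★ `eq324_torusGaugeTiltedDatum_allSteps` — THE CERTIFICATE: for every `d_T ≥ 2`, `L_T ≥ 1` and the (3.24) letters (`s`, `D`, `ϰ > 0`, `p₀ > 2∕3`,
  `σ > 0`, `c₀ ≥ 0`, `6 + 2κ₀ < σ(n̄ + 1)`): `∃ b₁ ∀ b₀ > b₁ ∃ C ≥ 0` such that for EVERY lattice approximation `S`, EVERY run step `k ≤ K`, EVERY budget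
  `v` with `C·v ≤ Ca + Cc`, EVERY cubic torus `(ℤ∕N)^{d_T}` (`L_T ∣ N`) and EVERY level `n ≥ 1` there are a bent window `Λ ⊂ ℤ^{2d_T+1}` and
  `e : B′ ≃ Λ` (`B′ = freeT L_T N`, ALL free bond variables; seat n08-d's `torusGauge_presentation` — chosen ONCE per step, before any history) such that,
  writing `A := reindex e e (Cᵀ·Re Δ_k·C)` and `K` for its zero-extended inverse (ONE law `𝒩(0,K)` presenting `𝒩(0,(Cᵀ·Re Δ_k·C)⁻¹)` on `B′ → ℝ`), for
  EVERY history-indexed family of nonempty regions `I h ⊆ Λ` with `|I h| ≤ v·|T₁^{(k)}|`, the region members `A|_{I h}` with zero-extended inverses `K₁ h`,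
  the tilts `Q_h` read off their formula (`K`, `K₁`, `Q` enter as binders with their DEFINING equations — abbreviations, inhabited by `rfl`), and EVERY
  (4.5)-letters `H_{J h U}` (`J h U ⊆ I h`, `sup|coeff| ≤ c₀ g_k^σ`):
  `∀ h U, Eq324 (∫_{{ω | ∀ b, e b ∈ I h → |ω_b| ≤ p(g_k)}} e^{H_{J h U}(ext_e ω) + Q_h(ext_e ω) + c_h} d𝒩(0,(Cᵀ·Re Δ_k·C)⁻¹))
  (n ↦ ℰ^T_{𝒩(0,K₁ h)}(H_{J h U}; n)) n̄ (Ca + Cc) (Lᵏg₀²) (3 + κ₀) |T₁^{(k)}|` — character for character the field `h324` (at print's letter) of the tower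
  datum whose step-`k` block is `((B′ → ℝ), 𝒩(0,(Cᵀ·Re Δ_k·C)⁻¹), box h, 𝒱 h U)` with `box h = {∀ b, e b ∈ I h → |ω_b| ≤ p(g_k)}` and
  `𝒱 h U = (H_{J h U} + Q_h + c_h) ∘ ext_e` (every other field zero ∕ empty).  Proof: seat n08-d's `torusGauge_presentation` (rows of `A` from `(d_T, L_T)`
  only, the Gaussian bridge, measurability of `z ↦ z ∘ e`) ∘ `…ClassMarginalTilt.eq324_tilt_submatrix_of_expDecay_on_unit` (ONE class member presents
  (3.24) for ALL its regions) at `η := g_k` ∘ part 14 §1 `h324RowAt_of_onePresentation_ae` at the literal datum, placed at level `k` of a tower by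
  `Function.update` (the box pulls back to print's region box as a SET, the potential pulls back as a FUNCTION — `hamiltonian_congr_eqOn` and the tilt read
  only coordinates in `I h ⊆ Λ`).
HONEST SCOPE.  A count-neutral CERTIFICATE (joint satisfiability ∕ non-vacuity of part 14's END at a NON-TRIVIAL printed datum: one law, regions varying
with the history, genuine tilts), ZERO BACKGROUND ONLY; which `(Λ₀, A, K, Φ)` NODE 00 pins as `(𝔖 k).μ`, which regions `Λ_{k+1}(h)`, the member at a
general background `U_{k+1}` (N06's [Balaban1985BackgroundPropagators] Sect. E rows) and whether the OTHER (α)-rows tolerate the tilted potential are NOT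
decided here — that is the IDENT, NOT made, NOT commissioned, NOT claimed; nothing of [Balaban1985UV3] ∕ [BenfattoEtAl1978] ∕ [Balaban1984PropagatorsII]
asserted beyond what cell pub-balaban and the class road proved; `PrintedUV3V` NOT proved; N08 NOT discharged; one finite 𝕋⁴ programme at fixed ε — R4
closes the conditional finite-𝕋⁴ rung `BalabanLadder.UV` only; nothing continuum ∕ ℝ⁴ ∕ OS ∕ mass gap ∕ Clay.

References: [Balaban1985UV3] T. Bałaban, CMP 102 (1985) 255–275 — (5) p. 256, (22) p. 261, (41) p. 266, (58) p. 270; [Balaban1984PropagatorsII]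
T. Bałaban, CMP 96 (1984) 223–250 — (2.152)–(2.157) pp. 249–250; [Balaban1982Higgs1] T. Bałaban, CMP 85 (1982) 603–636 — (3.24) p. 616; [BenfattoEtAl1978]
G. Benfatto et al., CMP 59 (1978) 143–166 — Lemma p. 152, (4.5) p. 151.
-/

noncomputable section

namespace Summit.QuantumFields.YangMills.Theorems.BalabanUVNodesN08AlphaEq324RowClassSocketEndTiltedTorusGauge

open MeasureTheory
open scoped BigOperators Nat Matrix
open Literature.MathematicalPhysics.QuantumFieldTheory (gaussianFieldOfKernel covGram)
open Literature.MathematicalPhysics.QuantumFieldTheory.GaussianToolkit (gaussZ)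
open Literature.MathematicalPhysics.QuantumFieldTheory.Balaban1983to89
open Literature.MathematicalPhysics.QuantumFieldTheory.Balaban1983to89.B1Sect3Statements (Eq324)
open Literature.MathematicalPhysics.QuantumFieldTheory.Balaban1983to89.B1Eq324BenfattoLemma
  (Coef hamiltonian coefSup truncatedExp cumulantSum)
open Literature.MathematicalPhysics.QuantumFieldTheory.Balaban1983to89.B1Eq324BenfattoSect5Eq515 (hamiltonian_congr_eqOn measurable_hamiltonian)
open Literature.MathematicalPhysics.QuantumFieldTheory.Balaban1983to89.B1Eq324BenfattoClassPresentation (measurable_restrictAlong)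
open Literature.MathematicalPhysics.QuantumFieldTheory.Balaban1983to89.B1Eq324BenfattoClassMarginalTilt
  (eq324_tilt_submatrix_of_expDecay_on_unit measurableSet_printBox)
open Literature.MathematicalPhysics.QuantumFieldTheory.Balaban1983to89.B1Eq324BenfattoClassTorusGaugeFluctuation (torusGauge_presentation)
open Literature.MathematicalPhysics.QuantumFieldTheory.Balaban1983to89.B6Lemma24Torus (pbox)
open Literature.MathematicalPhysics.QuantumFieldTheory.Balaban1983to89.B6Cov2156Torus (freeT elimT)
open Literature.MathematicalPhysics.QuantumFieldTheory.Balaban1983to89.B6Cov2156TorusDelK (reDelK gamma2153one gamma2153one_pos)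
open Literature.MathematicalPhysics.QuantumFieldTheory.Balaban1985CMP102.Setting
open Summit.QuantumFields.Balaban3D.Carriers
open Summit.QuantumFields.Balaban3D.Proofs.ScalesArithmetic (gk_pos gk_le_one)
open Summit.QuantumFields.Balaban3D.Proofs.Primitives (AlphaConsts)
open Summit.QuantumFields.Balaban3D.Proofs.GroupModelLieC (lieC)
open Summit.QuantumFields.YangMills.Theorems.BalabanUVNodesN08AlphaEq324RowClassSocketEndTilted (h324RowAt_of_onePresentation_ae)

variable {L : ℕ} {G : Type} [GaugeGroup G] [MeasurableSpace G] [HaarData G] (𝔊 : GroupModel G) (𝔠 : AlphaConsts L 𝔊.N)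

/-! ## §1 Glue: the block `(B′ → ℝ)` read on the bent window through `e : B′ ≃ Λ` -/

section Glue

variable {m : ℕ} {β : Type} {Λ : Finset (Fin m → ℤ)} (e : β ≃ ↥Λ)

/-- **Extension by zero along `e` agrees with `z` on the window**: reading the block variables `b ↦ z (e b)` back on `ℤ^m` through `e` returns `z x` at
every `x ∈ Λ`. [cite: BenfattoEtAl1978, §1 p.144 (class form; ours)] -/
theorem extAlong_apply_of_mem (z : (Fin m → ℤ) → ℝ) {x : Fin m → ℤ} (hx : x ∈ Λ) :
    (fun y : Fin m → ℤ => if hy : y ∈ Λ then (fun b : β => z ((e b : ↥Λ) : Fin m → ℤ)) (e.symm ⟨y, hy⟩) else (0 : ℝ)) x = z x := by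
  simp only [dif_pos hx, Equiv.apply_symm_apply]

/-- The extension-by-zero map `ω ↦ ext_e ω` from the block `β → ℝ` to `ℤ^m → ℝ` is measurable. [folklore]
[cite: BenfattoEtAl1978, §1 p.144 (class form; ours)] -/
theorem measurable_extAlong :
    Measurable fun (ω : β → ℝ) (x : Fin m → ℤ) => if hx : x ∈ Λ then ω (e.symm ⟨x, hx⟩) else (0 : ℝ) := by
  refine measurable_pi_lambda _ fun x => ?_
  by_cases hx : x ∈ Λ
  · simp only [dif_pos hx]; exact measurable_pi_apply _
  · simp only [dif_neg hx]; exact measurable_const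

/-- The history-dependent block box `{ω | ∀ b, e b ∈ I → |ω_b| ≤ p}` (print's region box `{|z_x| ≤ p, x ∈ I}` read on the block's own variables) is a
measurable event. [cite: Balaban1985UV3, (18) p.260, (58) p.270 (class form; ours)] -/
theorem measurableSet_blockBox [Fintype β] (I : Finset (Fin m → ℤ)) (p : ℝ) :
    MeasurableSet {ω : β → ℝ | ∀ b : β, ((e b : ↥Λ) : Fin m → ℤ) ∈ I → |ω b| ≤ p} := by
  have h : {ω : β → ℝ | ∀ b : β, ((e b : ↥Λ) : Fin m → ℤ) ∈ I → |ω b| ≤ p} =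
      ⋂ b : β, {ω : β → ℝ | ((e b : ↥Λ) : Fin m → ℤ) ∈ I → |ω b| ≤ p} := by
    ext ω; simp only [Set.mem_setOf_eq, Set.mem_iInter]
  rw [h]
  refine MeasurableSet.iInter fun b => ?_
  by_cases hb : ((e b : ↥Λ) : Fin m → ℤ) ∈ I
  · have h1 : {ω : β → ℝ | ((e b : ↥Λ) : Fin m → ℤ) ∈ I → |ω b| ≤ p} = {ω : β → ℝ | |ω b| ≤ p} := by
      ext ω; simp only [Set.mem_setOf_eq]; exact ⟨fun h' => h' hb, fun h' _ => h'⟩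
    rw [h1]
    exact measurableSet_le (continuous_abs.measurable.comp (measurable_pi_apply b)) measurable_const
  · have h1 : {ω : β → ℝ | ((e b : ↥Λ) : Fin m → ℤ) ∈ I → |ω b| ≤ p} = Set.univ := by
      ext ω; simp only [Set.mem_setOf_eq, Set.mem_univ, iff_true]; exact fun h' => absurd h' hb
    rw [h1]
    exact MeasurableSet.univ

/-- The pull-back of the block box along `z ↦ z ∘ e` IS print's region box on the window (a set identity, no null set), for a region `I ⊆ Λ`.
[cite: Balaban1985UV3, (58) p.270 (class form; ours)] -/
theorem preimage_blockBox_eq {I : Finset (Fin m → ℤ)} (hI : I ⊆ Λ) (p : ℝ) :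
    (fun (z : (Fin m → ℤ) → ℝ) (b : β) => z ((e b : ↥Λ) : Fin m → ℤ)) ⁻¹'
        {ω : β → ℝ | ∀ b : β, ((e b : ↥Λ) : Fin m → ℤ) ∈ I → |ω b| ≤ p} =
      {z : (Fin m → ℤ) → ℝ | ∀ x ∈ I, |z x| ≤ p} := by
  ext z
  simp only [Set.mem_preimage, Set.mem_setOf_eq]
  refine ⟨fun h x hx => ?_, fun h b hb => h _ hb⟩
  have h1 := h (e.symm ⟨x, hI hx⟩)
  simp only [Equiv.apply_symm_apply] at h1
  exact h1 hx

/-- When NODE 00 hands the region over on the BLOCK side as a sub-family `Bv ⊆ B′` of bond variables (`I = e(Bv)`), the block box of §2 IS the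
sub-family's own box `{|ω_b| ≤ p, b ∈ Bv}` (part 10's box per history). [cite: Balaban1985UV3, (58) p.270 (class form; ours)] -/
theorem blockBox_image_eq (Bv : Finset β) (p : ℝ) :
    {ω : β → ℝ | ∀ b : β, ((e b : ↥Λ) : Fin m → ℤ) ∈ Bv.image (fun b' : β => ((e b' : ↥Λ) : Fin m → ℤ)) → |ω b| ≤ p} =
      {ω : β → ℝ | ∀ b ∈ Bv, |ω b| ≤ p} := by
  ext ω
  simp only [Set.mem_setOf_eq, Finset.mem_image]
  refine ⟨fun h b hb => h b ⟨b, hb, rfl⟩, fun h b hb => ?_⟩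
  obtain ⟨b', hb', hbb'⟩ := hb
  have h1 : b' = b := e.injective (Subtype.val_injective hbb')
  exact h1 ▸ h b' hb'

end Glue

/-! ## §2 THE CERTIFICATE: one law per step, history-dependent regions and tilts — the pipeline fires -/

/-- ★★★★★★ **THE (3.24) ROW OF THE (α) CLAUSE, UNCONDITIONALLY, FROM ONE LAW PER STEP WITH HISTORY-DEPENDENT REGIONS** (statement in the module
docstring).  `b₁` depends on `(d_T, L_T, D, ϰ, p₀, σ, c₀, n̄, κ₀)` only; for `b₀ > b₁` the constant `C` on those and `b₀`; the bent window `(Λ, e)` on the torus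
size `N` and the level `n` only — ONE per step, before every history; the ONE law is the printed zero-background gauge-field fluctuation Gaussian
`𝒩(0,(Cᵀ·Re Δ_k·C)⁻¹)` on ALL free bond variables; the regions `I h`, the principal-block members `A|_{I h}`, the tilts `Q_h` and the (4.5)-letters vary with
the history (and the letters with the background).  The conclusion is, character for character, the row `h324` at print's cumulant letter for the literal tower
datum with that ONE block law, the history-dependent block boxes and the tilted potentials — part 14's END inhabited at a non-trivial printed datum.
[cite: Balaban1985UV3, (5) p.256 + (22) p.261 + (41) p.266 + (58) p.270; Balaban1984PropagatorsII, (2.152)–(2.157) pp.249–250; Balaban1982Higgs1, (3.24) p.616;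
BenfattoEtAl1978, Lemma p.152 + (4.5) p.151 (class form; ours)] -/
theorem eq324_torusGaugeTiltedDatum_allSteps {dT LT : ℕ} (hdT : 2 ≤ dT) (hLT : 1 ≤ LT)
    (s D : ℕ) {ϰ : ℝ} (hϰ : 0 < ϰ) {p₀ σ c₀ : ℝ} (hp₀ : 2 / 3 < p₀) (hσ : 0 < σ) (hc₀ : 0 ≤ c₀) (hκσ : 6 + 2 * 𝔠.κ₀ < σ * (𝔠.nbar + 1)) :
    ∃ b₁ : ℝ, ∀ b₀ : ℝ, b₁ < b₀ → ∃ C : ℝ, 0 ≤ C ∧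
      ∀ (S : Scales L) (k : ℕ), k ≤ S.K → ∀ (v : ℝ), C * v ≤ 𝔠.Ca + 𝔠.Cc →
        ∀ (N : ℕ) [NeZero N], LT ∣ N → ∀ (n : ℕ) (hn : 1 ≤ n),
        -- ONE bent window per step, for ALL free bond variables `B′ = freeT L_T N` of the torus
        ∃ (Λ : Finset (Fin (dT + dT + 1) → ℤ)) (e : ↥(freeT LT (fun _ : Fin dT => N)) ≃ ↥Λ),
        -- `K` = the zero-extended inverse of the ONE re-indexed precision `A = reindex e e (Cᵀ·Re Δ_k·C)` (read off its formula)
        ∀ (K : (Fin (dT + dT + 1) → ℤ) → (Fin (dT + dT + 1) → ℤ) → ℝ),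
          (∀ x y, K x y = if hxy : x ∈ Λ ∧ y ∈ Λ then
            ((Matrix.reindex e e ((elimT LT (fun _ : Fin dT => N))ᵀ * reDelK n hn (fun _ : Fin dT => N) *
              elimT LT (fun _ : Fin dT => N)))⁻¹ : Matrix ↥Λ ↥Λ ℝ) ⟨x, hxy.1⟩ ⟨y, hxy.2⟩ else 0) →
        -- per HISTORY: a nonempty region `I h ⊆ Λ` under the budget
        ∀ (I : Hist S.P (k + 1) → Finset (Fin (dT + dT + 1) → ℤ)) (hI : ∀ h, I h ⊆ Λ),
          (∀ h, (I h).Nonempty) → (∀ h, ((I h).card : ℝ) ≤ v * S.sites k) →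
        -- the region member = the PRINCIPAL BLOCK `A|_{I h}`; `K₁ h` its zero-extended inverse, `Q h` the tilt (both read off their formulas)
        ∀ (K₁ : Hist S.P (k + 1) → (Fin (dT + dT + 1) → ℤ) → (Fin (dT + dT + 1) → ℤ) → ℝ),
          (∀ h x y, K₁ h x y = if hxy : x ∈ I h ∧ y ∈ I h then
            (((Matrix.reindex e e ((elimT LT (fun _ : Fin dT => N))ᵀ * reDelK n hn (fun _ : Fin dT => N) *
                elimT LT (fun _ : Fin dT => N))).submatrix (fun j : ↥(I h) => (⟨j, hI h j.2⟩ : ↥Λ))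
                (fun j : ↥(I h) => (⟨j, hI h j.2⟩ : ↥Λ)))⁻¹ : Matrix ↥(I h) ↥(I h) ℝ) ⟨x, hxy.1⟩ ⟨y, hxy.2⟩ else 0) →
        ∀ (Q : Hist S.P (k + 1) → ((Fin (dT + dT + 1) → ℤ) → ℝ) → ℝ),
          (∀ h z, Q h z = -(1 / 2) * ∑ u : ↥(I h), ∑ w : ↥(I h),
            (((Matrix.reindex e e ((elimT LT (fun _ : Fin dT => N))ᵀ * reDelK n hn (fun _ : Fin dT => N) *
                elimT LT (fun _ : Fin dT => N))).submatrix (fun j : ↥(I h) => (⟨j, hI h j.2⟩ : ↥Λ))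
                (fun j : ↥(I h) => (⟨j, hI h j.2⟩ : ↥Λ))) u w - (covGram K (I h))⁻¹ u w) * z u * z w) →
        -- per (HISTORY, BACKGROUND): the (4.5)-letters on the region (class II)
        ∀ (J : Hist S.P (k + 1) → GaugeField S.P (k + 1) G → Finset (Fin (dT + dT + 1) → ℤ))
          (a : Hist S.P (k + 1) → GaugeField S.P (k + 1) G → Coef (dT + dT + 1)),
          (∀ h U, J h U ⊆ I h) → (∀ h U, coefSup s D (a h U) (J h U) ≤ c₀ * S.gk k ^ σ) →
        ∀ h (U : GaugeField S.P (k + 1) G),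
          Eq324 (∫ ω in {ω : ↥(freeT LT (fun _ : Fin dT => N)) → ℝ |
                ∀ b, ((e b : ↥Λ) : Fin (dT + dT + 1) → ℤ) ∈ I h → |ω b| ≤ B10.pFun b₀ p₀ (S.gk k)},
              Real.exp
                (hamiltonian s D ϰ (a h U) (J h U)
                    (fun x => if hx : x ∈ Λ then ω (e.symm ⟨x, hx⟩) else (0 : ℝ)) +
                  Q h (fun x => if hx : x ∈ Λ then ω (e.symm ⟨x, hx⟩) else (0 : ℝ)) +
                  Real.log ((gaussZ (covGram K (I h))⁻¹).toReal /
                    (gaussZ ((Matrix.reindex e e ((elimT LT (fun _ : Fin dT => N))ᵀ * reDelK n hn (fun _ : Fin dT => N) *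
                      elimT LT (fun _ : Fin dT => N))).submatrix (fun j : ↥(I h) => (⟨j, hI h j.2⟩ : ↥Λ))
                      (fun j : ↥(I h) => (⟨j, hI h j.2⟩ : ↥Λ)))).toReal))
              ∂gaussianFieldOfKernel fun b b' =>
                (((elimT LT (fun _ : Fin dT => N))ᵀ * reDelK n hn (fun _ : Fin dT => N) * elimT LT (fun _ : Fin dT => N))⁻¹ :
                  Matrix ↥(freeT LT (fun _ : Fin dT => N)) ↥(freeT LT (fun _ : Fin dT => N)) ℝ) b b')
            (fun m' => truncatedExp (gaussianFieldOfKernel (K₁ h)) (hamiltonian s D ϰ (a h U) (J h U)) m')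
            𝔠.nbar (𝔠.Ca + 𝔠.Cc) ((L : ℝ) ^ k * S.g0sq) (3 + 𝔠.κ₀) (S.sites k) := by
  classical
  -- seat n08-d's zero-background presentation: rows of `A` from `(d_T, L_T)` only, the Gaussian bridge, the box pull-back
  obtain ⟨KA, κA, hKA, hκA, hpres⟩ := torusGauge_presentation (d := dT) (L := LT) hdT hLT
  have hd' : 0 < dT + dT + 1 := by omega
  have hγ0 : 0 < gamma2153one dT LT := gamma2153one_pos (le_trans (by norm_num) hdT) hLT
  -- the class road: ONE class member presents (3.24) for ALL its regions, the region members tilted in the potential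
  obtain ⟨b₁, hb₁⟩ := eq324_tilt_submatrix_of_expDecay_on_unit (d := dT + dT + 1) hd' hγ0 hKA hκA 𝔠.nbar D hϰ hp₀ hσ hc₀
    (κ := 6 + 2 * 𝔠.κ₀) (by linarith [𝔠.κ₀_pos]) hκσ
  refine ⟨b₁, fun b₀ hb => ?_⟩
  obtain ⟨C, hC, hE⟩ := hb₁ b₀ hb
  refine ⟨C, hC, ?_⟩
  intro S k hk v hCv N _ hLN n hn
  obtain ⟨Λ, e, hsymm, hcoer, hdec, hbridge, -⟩ := hpres N hLN n hn
  refine ⟨Λ, e, ?_⟩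
  intro K hK I hI hIne hIv K₁ hK₁ Q hQ J a hJI hcoef
  -- the ONE law on the window: `K` IS the presented zero-extended inverse kernel
  have hKf : (fun x y : Fin (dT + dT + 1) → ℤ => if hxy : x ∈ Λ ∧ y ∈ Λ then
      ((Matrix.reindex e e ((elimT LT (fun _ : Fin dT => N))ᵀ * reDelK n hn (fun _ : Fin dT => N) *
        elimT LT (fun _ : Fin dT => N)))⁻¹ : Matrix ↥Λ ↥Λ ℝ) ⟨x, hxy.1⟩ ⟨y, hxy.2⟩ else 0) = K :=
    (funext fun x => funext fun y => hK x y).symm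
  rw [hKf] at hbridge
  -- the lattice-side potential `W h U = H_{J h U} + Q_h + c_h` (reads only coordinates in `I h ⊆ Λ`) and its measurability
  set W : Hist S.P (k + 1) → GaugeField S.P (k + 1) G → ((Fin (dT + dT + 1) → ℤ) → ℝ) → ℝ := fun h U z =>
    hamiltonian s D ϰ (a h U) (J h U) z + Q h z +
      Real.log ((gaussZ (covGram K (I h))⁻¹).toReal /
        (gaussZ ((Matrix.reindex e e ((elimT LT (fun _ : Fin dT => N))ᵀ * reDelK n hn (fun _ : Fin dT => N) *
          elimT LT (fun _ : Fin dT => N))).submatrix (fun j : ↥(I h) => (⟨j, hI h j.2⟩ : ↥Λ))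
          (fun j : ↥(I h) => (⟨j, hI h j.2⟩ : ↥Λ)))).toReal) with hW
  have hQm : ∀ h, Measurable (Q h) := fun h => by
    have hq : Q h = fun z => -(1 / 2) * ∑ u : ↥(I h), ∑ w : ↥(I h),
        (((Matrix.reindex e e ((elimT LT (fun _ : Fin dT => N))ᵀ * reDelK n hn (fun _ : Fin dT => N) *
            elimT LT (fun _ : Fin dT => N))).submatrix (fun j : ↥(I h) => (⟨j, hI h j.2⟩ : ↥Λ))
            (fun j : ↥(I h) => (⟨j, hI h j.2⟩ : ↥Λ))) u w - (covGram K (I h))⁻¹ u w) * z u * z w := funext (hQ h)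
    rw [hq]
    exact measurable_const.mul (Finset.measurable_sum _ fun u _ => Finset.measurable_sum _ fun w _ =>
      (measurable_const.mul (measurable_pi_apply _)).mul (measurable_pi_apply _))
  have hWm : ∀ h U, Measurable (W h U) := fun h U =>
    ((measurable_hamiltonian (s := s) (D := D) (κ := ϰ) (a := a h U) (J h U)).add (hQm h)).add measurable_const
  -- `W h U` reads only the coordinates in `Λ`: pull-back through `z ↦ ext_e (z ∘ e)` is the identity on it
  have hWext : ∀ h U (z : (Fin (dT + dT + 1) → ℤ) → ℝ),
      W h U (fun x => if hx : x ∈ Λ then (fun b : ↥(freeT LT (fun _ : Fin dT => N)) => z ((e b : ↥Λ) : Fin (dT + dT + 1) → ℤ))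
        (e.symm ⟨x, hx⟩) else (0 : ℝ)) = W h U z := by
    intro h U z
    generalize hX : (fun x : Fin (dT + dT + 1) → ℤ => if hx : x ∈ Λ then
      (fun b : ↥(freeT LT (fun _ : Fin dT => N)) => z ((e b : ↥Λ) : Fin (dT + dT + 1) → ℤ)) (e.symm ⟨x, hx⟩) else (0 : ℝ)) = X
    have hXmem : ∀ x : Fin (dT + dT + 1) → ℤ, x ∈ Λ → X x = z x := fun x hx => by
      rw [← hX]; exact extAlong_apply_of_mem e z hx
    have hH : hamiltonian s D ϰ (a h U) (J h U) X = hamiltonian s D ϰ (a h U) (J h U) z :=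
      hamiltonian_congr_eqOn (s := s) (D := D) (κ := ϰ) (a := a h U) (J h U) fun x hx => hXmem x (hI h (hJI h U hx))
    have hQ' : Q h X = Q h z := by
      rw [hQ h, hQ h]
      congr 1
      refine Finset.sum_congr rfl fun u _ => Finset.sum_congr rfl fun w _ => ?_
      rw [hXmem _ (hI h u.2), hXmem _ (hI h w.2)]
    simp only [hW, hH, hQ']
  -- THE LITERAL STEP BLOCK: ONE law, history-dependent box, tilted potential (every other field zero ∕ empty)
  let 𝔖k : StepSeries S G ↥(lieC 𝔊) (nblkOf S 𝔠.lane.carrier k) k :=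
    { Ψ := fun _ _ => 0, Bcfg := fun _ _ _ => 0, far := fun _ _ _ => 0, PY := fun _ _ => 0, PYZ := fun _ _ => 0,
      Gt := fun _ => { Γ := PEmpty, supp := ∅, E := fun γ _ => γ.elim, loc := fun γ => γ.elim, nv := fun γ => γ.elim,
                       pref := fun γ => γ.elim, lines := fun γ => γ.elim },
      Ndeg := fun _ => 0, oldVal := fun _ _ _ _ _ _ => 0,
      Fl := ↥(freeT LT (fun _ : Fin dT => N)) → ℝ,
      μ := gaussianFieldOfKernel fun b b' =>
        (((elimT LT (fun _ : Fin dT => N))ᵀ * reDelK n hn (fun _ : Fin dT => N) * elimT LT (fun _ : Fin dT => N))⁻¹ :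
          Matrix ↥(freeT LT (fun _ : Fin dT => N)) ↥(freeT LT (fun _ : Fin dT => N)) ℝ) b b',
      box := fun h => {ω : ↥(freeT LT (fun _ : Fin dT => N)) → ℝ |
        ∀ b, ((e b : ↥Λ) : Fin (dT + dT + 1) → ℤ) ∈ I h → |ω b| ≤ B10.pFun b₀ p₀ (S.gk k)},
      𝒱 := fun h U ω => W h U (fun x => if hx : x ∈ Λ then ω (e.symm ⟨x, hx⟩) else (0 : ℝ)),
      dimZ := fun _ => 0, QU := fun _ _ => 0, JU := fun _ _ => 0, Q1 := fun _ => 0, J1 := fun _ => 0, dimT := 0, QT := 0, JT := 0 }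
  -- a junk tower carrying `𝔖k` at level `k`
  let 𝔖junk : ∀ k', StepSeries S G ↥(lieC 𝔊) (nblkOf S 𝔠.lane.carrier k') k' := fun k' =>
    { Ψ := fun _ _ => 0, Bcfg := fun _ _ _ => 0, far := fun _ _ _ => 0, PY := fun _ _ => 0, PYZ := fun _ _ => 0,
      Gt := fun _ => { Γ := PEmpty, supp := ∅, E := fun γ _ => γ.elim, loc := fun γ => γ.elim, nv := fun γ => γ.elim,
                       pref := fun γ => γ.elim, lines := fun γ => γ.elim },
      Ndeg := fun _ => 0, oldVal := fun _ _ _ _ _ _ => 0,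
      Fl := Unit, μ := 0, box := fun _ => ∅, 𝒱 := fun _ _ _ => 0,
      dimZ := fun _ => 0, QU := fun _ _ => 0, JU := fun _ _ => 0, Q1 := fun _ => 0, J1 := fun _ => 0, dimT := 0, QT := 0, JT := 0 }
  let 𝔖 : ∀ k', StepSeries S G ↥(lieC 𝔊) (nblkOf S 𝔠.lane.carrier k') k' := Function.update 𝔖junk k 𝔖k
  have h𝔖 : 𝔖 k = 𝔖k :=
    Function.update_self (β := fun k' => StepSeries S G ↥(lieC 𝔊) (nblkOf S 𝔠.lane.carrier k') k') k 𝔖k 𝔖junk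
  -- part 14 §1's plug at the tower, transported to the literal block at level `k`
  have plug := h324RowAt_of_onePresentation_ae 𝔊 𝔠 (d := dT + dT + 1) 𝔖 k (v := v) (C := C) hC hCv
  rw [h𝔖] at plug
  exact plug (gaussianFieldOfKernel K)
    (fun z b => z ((e b : ↥Λ) : Fin (dT + dT + 1) → ℤ)) (measurable_restrictAlong e) hbridge.symm
    (fun h => measurableSet_blockBox e (I h) _) (fun h U => (hWm h U).comp (measurable_extAlong e))
    (fun h _ => {z : (Fin (dT + dT + 1) → ℤ) → ℝ | ∀ x ∈ I h, |z x| ≤ B10.pFun b₀ p₀ (S.gk k)})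
    (fun h _ => Filter.EventuallyEq.of_eq (preimage_blockBox_eq e (hI h) _))
    W (fun h U => Filter.EventuallyEq.of_eq (funext fun z => hWext h U z))
    (fun h _ => I h) (fun h _ => hIv h)
    (fun h U m' => truncatedExp (gaussianFieldOfKernel (K₁ h)) (hamiltonian s D ϰ (a h U) (J h U)) m')
    fun h U => by
      have hrow := hE (S.gk k) (gk_pos S k) (gk_le_one S S.gK_le_one k hk) hK hsymm hcoer hdec (hI h) (hIne h) (hK₁ h)
        s (J h U) (a h U) (hJI h U) (hcoef h U) (hQ h)
      rw [integral_indicator (measurableSet_printBox (I h) (B10.pFun b₀ p₀ (S.gk k)))] at hrow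
      simpa only [cumulantSum, hW] using hrow

end Summit.QuantumFields.YangMills.Theorems.BalabanUVNodesN08AlphaEq324RowClassSocketEndTiltedTorusGauge

end
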